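import Mathlib
import HarnessLib
import Summits.CriticalPhenomena.SAWScalingLimit.Theses.SAWDefectDecoherence

/-!
# Sketch — crux-ideate stmt-CriticalPhenomena-14004 (BoundaryClosureR), ideator 1 (gen 2), round 1

First-lemma signatures for the crux idea card `Ideas/quantised-corners-zero-budget.md`.
Nothing is proved here; every `def … : Prop` must elaborate over existing declarations.

* `RootRowWinding`  — exact lattice datum (the monodromy at the pinned root): on an exact
  zigzag row every SAW from the root dangling edge `a` to a row-mate dangling edge `e` to its
  right has winding `-π` (to its left `+π`), so `F(e) = Z(e)·e^{+5iπ/8}` right of `a` and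
  `Z(e)·e^{-5iπ/8}` left of `a`: the phase jump across the root is `e^{-5iπ/4}`, exactly the
  monodromy of `(z-a)^{-5/4}` across `a` inside the upper half-plane.
* `RootReflection`  — the continuum step at the root (pure Mathlib): a holomorphic integrable `g`
  on the upper half-disc whose `(z-a)^{5/4}`-weighted `∂̄`-pairing with every REAL test function
  of the whole disc is purely imaginary (after one fixed phase) continues, after multiplication
  by `(z-a)^{5/4}`, to a holomorphic function on the whole disc, real on the diameter
  (distributional Schwarz reflection + Weyl; no Laurent tail because the source weight kills it).
* `ParityOfPositiveTrace` — the parity lemma used at re-entrant corners: a holomorphic function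
  on the disc that is real and NON-NEGATIVE on the diameter and not identically zero vanishes at
  the centre to EVEN order with positive leading coefficient.
-/

namespace Summit.CriticalPhenomena.SAWScalingLimit.Cruxes.BoundaryClosureR.Ideator1g2Sketch

open scoped BigOperators ComplexConjugate Topology
open Filter Set MeasureTheory
open Literature.Probability.LatticeModels Literature.Probability.RandomPlanarGeometry
open Literature.Probability.RandomPlanarGeometry.SAW
open Summit.CriticalPhenomena.SAWScalingLimit.Theses.SAWDefectDecoherence

/-- The up-face `((j, m), 0)` of the cell `(j, m)`. -/
def upFace (j m : ℤ) : HexVertex := (![j, m], 0)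

/-- The down-face `((j, m), 1)` of the cell `(j, m)`. -/
def downFace (j m : ℤ) : HexVertex := (![j, m], 1)

/-- The vertical dangling edge hanging below the up-face of the cell `(j, m)` (its lower endpoint
is the down-face of the cell `(j, m-1)`); on the exact half-lattice `{v | m ≤ v.1 1}` these are
precisely the boundary mid-edges of the flat zigzag row, all of ONE lattice class. -/
def rowEdge (j m : ℤ) : Sym2 HexVertex := s(upFace j m, downFace j (m - 1))

/-- FIRST LEMMA (exact, provable now from `BoundaryWindingRigidity` stmt-8515 + one reference
walk): **root-row winding**. If `Λ` is simply connected, the row-`m` dangling edges at columns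
`j₀ < j₁` are boundary mid-edges (their lower endpoints are outside `Λ`), and the zigzag of up- and
down-faces of row `m` between them lies in `Λ` (true inside a pinned half-lattice ball), then EVERY
self-avoiding walk from `rowEdge j₀ m` to `rowEdge j₁ m` has winding exactly `-π` (and `+π` from
`rowEdge j₁ m` to `rowEdge j₀ m`). Consequence: `F_{x,σ}(e) = Z(e)·exp(+iσπ)` for row edges right
of the root and `Z(e)·exp(-iσπ)` left of it — at `σ = 5/8` the phase jump across the root is
`exp(-5iπ/4)`, the monodromy of `(z-a)^{-5/4}`. [cite: DuminilCopinSmirnov2012, §3 (windings to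
the boundary of the strip are rigid: 0, ±π)] -/
def RootRowWinding : Prop :=
  ∀ (Λ : Finset HexVertex) (m j₀ j₁ : ℤ), j₀ < j₁ →
    hexDomainSimplyConnected Λ →
    downFace j₀ (m - 1) ∉ Λ → downFace j₁ (m - 1) ∉ Λ →
    (∀ j : ℤ, j₀ ≤ j → j ≤ j₁ → upFace j m ∈ Λ) →
    (∀ j : ℤ, j₀ ≤ j → j < j₁ → downFace j m ∈ Λ) →
    (∀ γ : HexMidEdgeSAW Λ (rowEdge j₀ m) (rowEdge j₁ m), γ.winding = -Real.pi) ∧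
    (∀ γ : HexMidEdgeSAW Λ (rowEdge j₁ m) (rowEdge j₀ m), γ.winding = Real.pi)

/-- The open upper half of the unit disc. -/
def upperHalfDisc : Set ℂ := {z : ℂ | 0 < z.im ∧ ‖z‖ < 1}

/-- CONTINUUM STEP AT THE ROOT (pure Mathlib; distributional Schwarz reflection + Weyl's lemma):
let `g` be holomorphic and area-integrable on the upper half-disc (root at `0`), and suppose that
for one fixed phase `θ` and EVERY real test function `φ ∈ C²_c` of the WHOLE unit disc the weighted
pairing `e^{-iθ} ∬ z^{5/4} g(z) (φ_x + i φ_y)(z) dA` is purely imaginary (this is what the exact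
weighted Green identity with the holomorphic weight `u = e^{iθ}(z-a)^{5/4}φ` delivers in the limit:
`u(a) = 0` kills the divergent source term `δ/Z(a,b)`, the row arrivals dressed by `|x-a|^{5/4}`
are finite, and their phases `e^{∓5iπ/8}` on the two sides are made EQUAL by the monodromy of
`(z-a)^{5/4}`). Then `e^{-iθ} z^{5/4} g` is the restriction of a function holomorphic on the whole
disc and real on the diameter; in particular the order of `g` at the root is `-5/4 + n`, `n ∈ ℕ`
(no Laurent tail: the weight `(z-a)^{5/4}` is exactly what area-integrability of `g` affords).
[folklore: Schwarz reflection for distributional boundary values; Weyl's lemma] -/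
def RootReflection : Prop :=
  ∀ (g : ℂ → ℂ) (θ : ℝ),
    DifferentiableOn ℂ g upperHalfDisc →
    IntegrableOn g upperHalfDisc volume →
    (∀ φ : ℂ → ℝ, ContDiff ℝ 2 φ → HasCompactSupport φ → tsupport φ ⊆ Metric.ball (0 : ℂ) 1 →
      (Complex.exp (-(θ : ℂ) * Complex.I) *
        ∫ z in upperHalfDisc, z ^ ((5 : ℂ) / 4) * g z *
          (((fderiv ℝ φ z (1 : ℂ) : ℝ) : ℂ) + Complex.I * ((fderiv ℝ φ z Complex.I : ℝ) : ℂ))).re = 0) →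
    ∃ G : ℂ → ℂ, DifferentiableOn ℂ G (Metric.ball (0 : ℂ) 1) ∧
      (∀ z ∈ upperHalfDisc, G z = Complex.exp (-(θ : ℂ) * Complex.I) * z ^ ((5 : ℂ) / 4) * g z) ∧
      (∀ x : ℝ, |x| < 1 → (G (x : ℂ)).im = 0)

/-- PARITY LEMMA (pure Mathlib; used at every re-entrant corner after straightening
`w = (z-c)^{1/α}` and at the root): a function holomorphic on the unit disc which is real and
non-negative on the whole diameter and not identically zero near the centre vanishes there to
EVEN order with a positive leading coefficient: `G(z)/z^{2n} → c > 0`. (The trace of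
`g/(Φ')^{5/8}` on the two sides of a lattice corner is a POSITIVE arrival measure with one
common phase — positivity of SAW counts plus the exact side phases — so after straightening the
leading index is even; local finiteness of the arrival measure leaves only the indices `≥ -1`,
hence `≥ 0`: the corner exponent is at least the conformal one, at every corner angle.)
[folklore] -/
def ParityOfPositiveTrace : Prop :=
  ∀ (G : ℂ → ℂ), DifferentiableOn ℂ G (Metric.ball (0 : ℂ) 1) →
    (∀ x : ℝ, |x| < 1 → (G (x : ℂ)).im = 0 ∧ 0 ≤ (G (x : ℂ)).re) →
    (¬ ∀ᶠ z in 𝓝 (0 : ℂ), G z = 0) →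
    ∃ n : ℕ, ∃ c : ℝ, 0 < c ∧
      Tendsto (fun z : ℂ => G z / z ^ (2 * n)) (𝓝[≠] (0 : ℂ)) (𝓝 (c : ℂ))

end Summit.CriticalPhenomena.SAWScalingLimit.Cruxes.BoundaryClosureR.Ideator1g2Sketch
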